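import Literature.AlgebraicGeometry.AbelianSchemes.AbelianSchemeTheoremOfCubeUnconditional
import Literature.AlgebraicGeometry.AbelianSchemes.AbelianSchemeOverZariskiGluingLevel
import Literature.AlgebraicGeometry.AbelianSchemes.AbelianSchemeOverLevelBaseChange
import Literature.AlgebraicGeometry.AbelianSchemes.RigidifiedTrivialOfOpenCover
import Literature.AlgebraicGeometry.AbelianSchemes.PoincareUniversalLocality
import HarnessLib

/-!
# The theorem of the cube and the theorem of the square for an abelian scheme over a LOCALLY NOETHERIAN base,
# UNCONDITIONAL (globalisation of ★ `AbelianSchemeTheoremOfCubeUnconditional`)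

Layer `Literature/AlgebraicGeometry/AbelianSchemes`, namespace `Literature.AlgebraicGeometry.AbelianSchemes.AbelianSchemeOver`.
THEOREMS ONLY (no definition, no named fact, no instance, no notation, no `sorry`).  Cell `hodgecm-mathlib` (D-0151), F-DAG row
F-2d «theorem of the square / cube over a possibly NON-REDUCED base», road (R-def) brick γ2 «globalisation» (author B-p07 (g17)).

SETTING AND NOTATION as in ★ γ1 (`AbelianSchemeTheoremOfCubeUnconditional`): `A/S` an abelian scheme, `c ∈ Ȟ¹(A, 𝒪^×)` with
`ε^*c = 1`, `Λ(x, y) = (x, y)^*[Λ]c`, cube class `Θ(x, y, z) = Λ(x, y·z)·Λ(x, y)⁻¹·Λ(x, z)⁻¹` of three `T`-points (spelled inline).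
★ γ1 `cubeClass_eq_one` is the case `S = Spec R`, `R` Noetherian (where the relative seesaw subscheme ★ E12 lives).  Here:

* §1 TRANSFER ALONG A BASE-CHANGE SQUARE OF GROUP SCHEMES (★ `IsBaseChangeVia`, `G : A′ → A` over `g : S′ → S`):
  `IsBaseChangeVia.pullback_lift_left_mumfordClass_pullback` — `Λ_{A′}^{G^*c}(x′, y′) = Λ_A^c(x′G, y′G)` on `T′` for `S′`-points
  `x′, y′` of `A′` and their `S`-transposes `x′G = pushHom x′` (★ `pushHom`, multiplicative ★ `pushHom_mul`);
  `IsBaseChangeVia.pullback_unitSection_pullback_eq_one` — `G^*c` is rigidified when `c` is.  Plumbing: the zero section of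
  `A_T` is the point `(1, 𝟙_T)` (`unitSection_baseChange_eq_lift_left`); `1_A × w = A ◁ w` (`prodMap_eq_whiskerLeft_left`).
* §2 **`cubeClass_eq_one_of_fac` — THE CUBE FOR TEST SCHEMES OVER A NOETHERIAN AFFINE PIECE OF THE BASE**: for ANY base `S`,
  if `T → S` factors through some `Spec R → S` with `R` Noetherian, then `Θ(x, y, z) = 1` for all `x, y, z : T → A`
  (★ γ1 for `A ×_S Spec R` over `Spec R`, transferred by §1; every `S`-point of `A` from `T` is the transpose of an `R`-point of
  `A ×_S Spec R`, ★ `pushHomMulEquiv`).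
* §3 **`cubeClass_eq_one_of_isLocallyNoetherian` — THE THEOREM OF THE CUBE over a LOCALLY NOETHERIAN base, unconditional**:
  `Θ(x, y, z) = 1` for every `S`-scheme `T` and all `x, y, z : T → A` ([MumfordAV1970] §6 Cor. 2 / §10; [GortzWedhorn2023]
  Lemma 24.72).  PROOF: the universal class `Θ(p_A, p₁, p₂)` on `A ×_S (A ×_S A)` is a class on the abelian scheme
  `A_{T′} → T′ := A ×_S A` RIGIDIFIED along the zero section (face `x = 0`, ★ `cubeClass_one_left`) and trivial over the members
  `T′ ×_S Spec Rᵢ` of the pull-back of an affine open cover of `S` (§2); such a class is trivial — triviality of a rigidified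
  class on `A_{T′}` is ZARISKI-LOCAL on `T′` (★ `cechPic_eq_one_of_cover_of_unitSection_of_steinAt`, Stein by ★
  `baseChange_app_bijective`, [MumfordAV1970] §5 Cor. 6 / [GortzWedhorn2023] Lemma 24.67); then evaluate at the point
  `(x, (y, z)) : T → A ×_S (A ×_S A)`.
* §4 **THE THEOREM OF THE SQUARE over a locally Noetherian base, unconditional**:
  `cechPic_pullback_whiskerLeft_mul_mumfordClass_of_isLocallyNoetherian` (`(1 × (u·v))^*[Λ]c = (1 × u)^*[Λ]c · (1 × v)^*[Λ]c`) and
  `nonempty_pullback_whiskerLeft_mul_mumfordBundle_iso_of_isLocallyNoetherian` (`Λ(L)|_{u·v} ≅ Λ(L)|_u ⊗ Λ(L)|_v`) — the ★ (R-dual)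
  heads `cechPic_pullback_whiskerLeft_mul_mumfordClass` / `nonempty_pullback_whiskerLeft_mul_mumfordBundle_iso`
  (`AbelianSchemeTheoremOfSquareOfDualPair`) with the dual pair `(D, hD)` AND `[PreconnectedSpace S]` REMOVED
  ([MumfordAV1970] §6 Cor. 4; [MumfordFogartyKirwan1994] Ch. 6 §2 p. 120 «`Λ(L)` is a homomorphism»).

Universe: `S : Scheme.{0}` (★ E12 / γ1 are universe `0`).  NOT here: bases that are not locally Noetherian (the Stein input
★ `baseChange_app_bijective` wants `IsLocallyNoetherian S`; §2 has no hypothesis on `S`).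

HC_CM is proved only modulo the 7 printed citations until rung 0 closes; nothing here is about HC.

## References
* [MumfordAV1970] D. Mumford, *Abelian Varieties* (1970), §5 Cor. 6 (p. 54), §6 Cor. 2 (p. 58), Cor. 4 (p. 59), §10 (p. 89),
  §13 (proof of the Thm., p. 125).
* [GortzWedhorn2023] U. Görtz, T. Wedhorn, *Algebraic Geometry II* (2023), Lemma 24.67, Lemma 24.72 (p. 409).
* [MumfordFogartyKirwan1994] D. Mumford, J. Fogarty, F. Kirwan, *Geometric Invariant Theory*, 3rd ed. (1994), Ch. 6 §2
  Definition 6.2 (p. 120), p. 121; Ch. 7 §2 Definition 7.2 (p. 129).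
* [GortzWedhorn2020] U. Görtz, T. Wedhorn, *Algebraic Geometry I*, 2nd ed. (2020), Section (4.7) (pp. 107–108), Section (4.15)
  (p. 116), Remark 16.54.
-/

set_option autoImplicit false

noncomputable section

-- `Scheme.Modules` / `SheafOfModules` are not reducible; `(A.X ⊗ T).left = pullback A.X.hom T.hom = (A.baseChange T.hom).left`
-- hold by `rfl` only.
set_option backward.isDefEq.respectTransparency false

open CategoryTheory CategoryTheory.Limits AlgebraicGeometry MonoidalCategory CartesianMonoidalCategory
open scoped MonObj

universe u

namespace Literature.AlgebraicGeometry.AbelianSchemes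

open Literature.AlgebraicGeometry.Motives Literature.AlgebraicGeometry.Modules
  Literature.AlgebraicGeometry.AbelianVarieties

namespace AbelianSchemeOver

/-! ## §1 Transfer of `Λ` and of the rigidification along a base-change square; plumbing -/

section Transfer

variable {S S' : Scheme.{u}} {A' : AbelianSchemeOver S'} {A : AbelianSchemeOver S} {g : S' ⟶ S}
  {G : A'.X.left ⟶ A.X.left} (c : CechPic A.left)

/-- **`Λ` transfers along a base-change square of group schemes**: for `G : A′ → A` over `g : S′ → S` (★ `IsBaseChangeVia`),
`S′`-points `x′, y′ : T′ → A′` and their `S`-transposes `x′G, y′G : T′ → A` (★ `pushHom`),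
`(x′, y′)^*[Λ_{A′}](G^*c) = (x′G, y′G)^*[Λ_A]c` in `Ȟ¹(T′, 𝒪^×)` — because `Λ(x, y) = (x·y)^*c·(x^*c)⁻¹·(y^*c)⁻¹`
(★ `pullback_lift_mumfordClass`) and `G` is multiplicative on points (★ `pushHom_mul`); [GortzWedhorn2020] (4.15)
«`(G ×_S S′)_{S′}(T) = G_S(T)`». [cite: GortzWedhorn2020, Section (4.15) (p. 116)] [cite: MumfordFogartyKirwan1994, Ch. 6 §2 Definition 6.2 (p. 120)] -/
theorem IsBaseChangeVia.pullback_lift_left_mumfordClass_pullback (h : A'.IsBaseChangeVia A g G) {T' : Over S'}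
    (x' y' : T' ⟶ A'.X) :
    CechPic.pullback (lift x' y').left (A'.mumfordClass (CechPic.pullback G c)) =
      CechPic.pullback (lift (h.pushHom x') (h.pushHom y')).left (A.mumfordClass c) := by
  rw [A'.pullback_lift_mumfordClass, A.pullback_lift_mumfordClass, ← h.pushHom_mul, h.pushHom_left, h.pushHom_left,
    h.pushHom_left, CechPic.pullback_comp, CechPic.pullback_comp, CechPic.pullback_comp]
  rfl

/-- **A rigidification transfers along a base-change square**: `ε_{A′}^*(G^*c) = g^*(ε_A^*c) = 1` (unit clause of
★ `IsBaseChangeVia`: `ε_{A′} ≫ G = g ≫ ε_A`). [cite: GortzWedhorn2020, Section (4.15) (p. 116)] [cite: MumfordFogartyKirwan1994, Ch. 6 §2 (p. 121)] -/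
theorem IsBaseChangeVia.pullback_unitSection_pullback_eq_one (h : A'.IsBaseChangeVia A g G)
    (hc : CechPic.pullback A.unitSection c = 1) :
    CechPic.pullback A'.unitSection (CechPic.pullback G c) = 1 := by
  rw [← CechPic.pullback_comp]
  change CechPic.pullback ((η[A'.X]).left ≫ G) c = 1
  rw [h.snd.2.1, CechPic.pullback_comp]
  change CechPic.pullback g (CechPic.pullback A.unitSection c) = 1
  rw [hc, map_one]

end Transfer

section Plumbing

variable {S : Scheme.{u}} (A : AbelianSchemeOver S) {T : Over S}

/-- **The zero section of `A_T` is the point `(1, 𝟙_T) : T → A ×_S T`** (★ `unitSection_baseChange_comp_fst`: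
`ε_{A_T} ≫ pr_A = T.hom ≫ ε_A`, and `ε_{A_T} ≫ pr_T = 𝟙`). [cite: GortzWedhorn2020, Section (4.7) (pp. 107–108)] -/
theorem unitSection_baseChange_eq_lift_left :
    (A.baseChange T.hom).unitSection = (lift (1 : T ⟶ A.X) (𝟙 T)).left := by
  apply pullback.hom_ext
  · rw [A.unitSection_baseChange_comp_fst T.hom, ← Over.fst_left, ← Over.comp_left, lift_fst, Hom.one_def,
      Over.comp_left, Over.toUnit_left]
  · change (A.baseChange T.hom).unitSection ≫ (A.baseChange T.hom).X.hom = _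
    rw [(A.baseChange T.hom).unitSection_comp_hom, ← Over.snd_left, ← Over.comp_left, lift_snd, Over.id_left]

/-- **`1_A × w = A ◁ (w, ·)`**: the ★ `prodMap` of `w : T₁ → T` (over `S` through `w ≫ T.hom`) is the underlying morphism of the
whiskering of the `S`-morphism `(w, ·) : (T₁ → S) ⟶ T`. [cite: GortzWedhorn2020, Section (4.7) (pp. 107–108)] -/
theorem prodMap_eq_whiskerLeft_left {T₁ : Scheme.{u}} (w : T₁ ⟶ T.left) :
    A.prodMap (w ≫ T.hom) T.hom w rfl = (A.X ◁ (Over.homMk w rfl : Over.mk (w ≫ T.hom) ⟶ T)).left := by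
  apply pullback.hom_ext
  · rw [A.prodMap_fst]
    exact (Over.whiskerLeft_left_fst (R := A.X) (Over.homMk w rfl : Over.mk (w ≫ T.hom) ⟶ T)).symm
  · rw [A.prodMap_snd]
    exact (Over.whiskerLeft_left_snd (R := A.X) (Over.homMk w rfl : Over.mk (w ≫ T.hom) ⟶ T)).symm

end Plumbing

/-! ## §2 The cube for test schemes over a Noetherian affine piece of the base -/

section Local

variable {S : Scheme.{0}} (A : AbelianSchemeOver S) (c : CechPic A.left)

/-- **THE CUBE FOR TEST SCHEMES MAPPING TO A NOETHERIAN AFFINE PIECE OF THE BASE** (no hypothesis on `S`): if `T → S` factors as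
`T → Spec R → S` with `R` Noetherian, then `Θ(x, y, z) = Λ(x, y·z)·Λ(x, y)⁻¹·Λ(x, z)⁻¹ = 1` in `Ȟ¹(T, 𝒪^×)` for all
`x, y, z : T → A` over `S` and every `c` with `ε^*c = 1` — ★ γ1 `cubeClass_eq_one` for the abelian scheme `A ×_S Spec R` over
`Spec R` and the class `pr_A^*c`, transferred by §1 (every `S`-point of `A` from `T` is the transpose of an `R`-point of
`A ×_S Spec R`, ★ `IsBaseChangeVia.pushHomMulEquiv`). [cite: MumfordAV1970, §6 (theorem of the cube and its proof) and §10 (p. 89)]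
[cite: GortzWedhorn2020, Section (4.15) (p. 116)] -/
theorem cubeClass_eq_one_of_fac (hc : CechPic.pullback A.unitSection c = 1) {R : CommRingCat.{0}} [IsNoetherianRing R]
    (g₀ : Spec R ⟶ S) {T : Over S} (s₀ : T.left ⟶ Spec R) (hT : T.hom = s₀ ≫ g₀) (x y z : T ⟶ A.X) :
    CechPic.pullback (lift x (y * z)).left (A.mumfordClass c) *
        (CechPic.pullback (lift x y).left (A.mumfordClass c))⁻¹ *
          (CechPic.pullback (lift x z).left (A.mumfordClass c))⁻¹ = 1 := by
  have h := A.baseChange_isBaseChangeVia g₀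
  -- `T` as an `R`-scheme and the comparison `e : (T → Spec R → S) ⟶ T` with `e.left = 𝟙`
  let T' : Over (Spec R) := Over.mk s₀
  let e : Over.mk (T'.hom ≫ g₀) ⟶ T := Over.homMk (𝟙 T.left) ((Category.id_comp _).trans hT)
  have key := A.pullback_left_cubeClass c e x y z
  change CechPic.pullback (𝟙 T.left) _ = _ at key
  rw [CechPic.pullback_id_apply] at key
  rw [key]
  -- the points `e ≫ x, e ≫ y, e ≫ z` are transposes of `R`-points of `A_R`
  obtain ⟨x', hx'⟩ := (h.pushHomMulEquiv T').surjective (e ≫ x)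
  obtain ⟨y', hy'⟩ := (h.pushHomMulEquiv T').surjective (e ≫ y)
  obtain ⟨z', hz'⟩ := (h.pushHomMulEquiv T').surjective (e ≫ z)
  rw [IsBaseChangeVia.pushHomMulEquiv_apply] at hx' hy' hz'
  rw [← hx', ← hy', ← hz', ← h.pushHom_mul, ← IsBaseChangeVia.pullback_lift_left_mumfordClass_pullback c h,
    ← IsBaseChangeVia.pullback_lift_left_mumfordClass_pullback c h,
    ← IsBaseChangeVia.pullback_lift_left_mumfordClass_pullback c h]
  exact (A.baseChange g₀).cubeClass_eq_one _ (IsBaseChangeVia.pullback_unitSection_pullback_eq_one c h hc) x' y' z'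

end Local

/-! ## §3 The theorem of the cube over a locally Noetherian base -/

section Global

variable {S : Scheme.{0}} [IsLocallyNoetherian S] (A : AbelianSchemeOver S) (c : CechPic A.left)

/-- **THE THEOREM OF THE CUBE for an abelian scheme over a LOCALLY NOETHERIAN base — UNCONDITIONAL** ([MumfordAV1970] §6 Cor. 2
over a field; §10 / [GortzWedhorn2023] Lemma 24.72 over a base): for `c ∈ Ȟ¹(A, 𝒪^×)` with `ε^*c = 1`, every `S`-scheme `T` and
all `x, y, z : T → A`, `Θ(x, y, z) = Λ(x, y·z)·Λ(x, y)⁻¹·Λ(x, z)⁻¹ = 1` in `Ȟ¹(T, 𝒪^×)`.  Proof: the universal class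
`Θ(p_A, p₁, p₂)` on `A ×_S (A ×_S A) = A_{T′}`, `T′ = A ×_S A`, is rigidified along the zero section (★ `cubeClass_one_left`) and
trivial over each `T′ ×_S Spec Rᵢ` for an affine open cover `Spec Rᵢ` of `S` (§2), hence trivial: triviality of a rigidified
class on `A_{T′}` is Zariski-local on `T′` (★ `cechPic_eq_one_of_cover_of_unitSection_of_steinAt`, Stein by ★
`baseChange_app_bijective`); then evaluate at `(x, (y, z))`. [cite: MumfordAV1970, §6 (theorem of the cube and its proof) and §10 (p. 89)]
[cite: GortzWedhorn2023, Lemma 24.72 (p. 409)] -/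
theorem cubeClass_eq_one_of_isLocallyNoetherian (hc : CechPic.pullback A.unitSection c = 1) {T : Over S}
    (x y z : T ⟶ A.X) :
    CechPic.pullback (lift x (y * z)).left (A.mumfordClass c) *
        (CechPic.pullback (lift x y).left (A.mumfordClass c))⁻¹ *
          (CechPic.pullback (lift x z).left (A.mumfordClass c))⁻¹ = 1 := by
  -- the universal object `P = A × T'`, `T' = A × A`, and the universal class `κ = Θ(p_A, p_{T'} ≫ p₁, p_{T'} ≫ p₂)`
  obtain ⟨κ, hκ⟩ : ∃ κ : CechPic (A.X ⊗ (A.X ⊗ A.X)).left, κ =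
      CechPic.pullback (lift (fst A.X (A.X ⊗ A.X))
          ((snd A.X (A.X ⊗ A.X) ≫ fst A.X A.X) * (snd A.X (A.X ⊗ A.X) ≫ snd A.X A.X))).left (A.mumfordClass c) *
        (CechPic.pullback (lift (fst A.X (A.X ⊗ A.X)) (snd A.X (A.X ⊗ A.X) ≫ fst A.X A.X)).left (A.mumfordClass c))⁻¹ *
          (CechPic.pullback (lift (fst A.X (A.X ⊗ A.X)) (snd A.X (A.X ⊗ A.X) ≫ snd A.X A.X)).left (A.mumfordClass c))⁻¹ :=
    ⟨_, rfl⟩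
  have hnat : ∀ {Q : Over S} (g : Q ⟶ A.X ⊗ (A.X ⊗ A.X)), CechPic.pullback g.left κ =
      CechPic.pullback (lift (g ≫ fst _ _) ((g ≫ snd _ _ ≫ fst _ _) * (g ≫ snd _ _ ≫ snd _ _))).left (A.mumfordClass c) *
        (CechPic.pullback (lift (g ≫ fst _ _) (g ≫ snd _ _ ≫ fst _ _)).left (A.mumfordClass c))⁻¹ *
          (CechPic.pullback (lift (g ≫ fst _ _) (g ≫ snd _ _ ≫ snd _ _)).left (A.mumfordClass c))⁻¹ := by
    intro Q g
    rw [hκ, A.pullback_left_cubeClass]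
  -- `κ = 1`: a rigidified class on `A_{T'}`, locally trivial over an affine cover of `S`
  have hκ1 : κ = 1 := by
    refine A.cechPic_eq_one_of_cover_of_unitSection_of_steinAt (A.X ⊗ A.X).hom
      (A.baseChange_app_bijective (A.X ⊗ A.X).hom) (S.affineOpenCover.openCover.pullback₁ (A.X ⊗ A.X).hom) κ
      (fun i => ?_) ?_
    · -- over `T' ×_S Spec Rᵢ`: §2
      rw [A.prodMap_eq_whiskerLeft_left]
      change CechPic.pullback (A.X ◁ _).left κ = 1
      rw [hnat]
      haveI : IsNoetherianRing (S.affineOpenCover.X i) :=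
        AlgebraicGeometry.isLocallyNoetherian_Spec.mp
          (inferInstanceAs (IsLocallyNoetherian (S.affineOpenCover.openCover.X i)))
      refine A.cubeClass_eq_one_of_fac c hc (S.affineOpenCover.f i)
        ((snd A.X _).left ≫ S.affineOpenCover.openCover.pullbackHom (A.X ⊗ A.X).hom i) ?_ _ _ _
      rw [Category.assoc]
      erw [Scheme.Cover.pullbackHom_map]
      exact (Over.w (snd A.X _)).symm
    · -- along the zero section of `A_{T'}`: the face `x = 0`
      rw [A.unitSection_baseChange_eq_lift_left]
      change CechPic.pullback (lift (1 : A.X ⊗ A.X ⟶ A.X) (𝟙 _)).left κ = 1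
      rw [hnat]
      have e1 : lift (1 : A.X ⊗ A.X ⟶ A.X) (𝟙 _) ≫ fst _ _ = 1 := by simp
      have e2 : lift (1 : A.X ⊗ A.X ⟶ A.X) (𝟙 _) ≫ snd _ _ ≫ fst _ _ = fst A.X A.X := by simp
      have e3 : lift (1 : A.X ⊗ A.X ⟶ A.X) (𝟙 _) ≫ snd _ _ ≫ snd _ _ = snd A.X A.X := by simp
      rw [e1, e2, e3]
      exact A.cubeClass_one_left c hc _ _
  -- evaluate at `(x, (y, z)) : T → A × (A × A)`
  have key := hnat (lift x (lift y z))
  rw [hκ1, map_one] at key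
  have e1 : lift x (lift y z) ≫ fst _ _ = x := by simp
  have e2 : lift x (lift y z) ≫ snd _ _ ≫ fst _ _ = y := by simp
  have e3 : lift x (lift y z) ≫ snd _ _ ≫ snd _ _ = z := by simp
  rw [e1, e2, e3] at key
  exact key.symm

/-! ## §4 The theorem of the square over a locally Noetherian base -/

/-- **THE THEOREM OF THE SQUARE for an abelian scheme over a LOCALLY NOETHERIAN base — UNCONDITIONAL** (class form): for
`c ∈ Ȟ¹(A, 𝒪^×)` rigidified along the zero section and all `u, v : T → A` over `S`,
`(1_A × (u·v))^*[Λ]c = (1_A × u)^*[Λ]c · (1_A × v)^*[Λ]c` in `Ȟ¹(A ×_S T, 𝒪^×)` — [MumfordAV1970] §6 Cor. 4,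
[MumfordFogartyKirwan1994] Ch. 6 §2 p. 120 «`Λ(L)` is a homomorphism `X → Pic(X/S)`»; the cube at `(p_A, p_T ≫ u, p_T ≫ v)`.
No dual pair, no reducedness, no connectedness (compare ★ `cechPic_pullback_whiskerLeft_mul_mumfordClass`).
[cite: MumfordAV1970, §6 Cor. 4 (p. 59)] [cite: MumfordFogartyKirwan1994, Ch. 6 §2 Definition 6.2 (p. 120)] -/
theorem cechPic_pullback_whiskerLeft_mul_mumfordClass_of_isLocallyNoetherian (hc : CechPic.pullback A.unitSection c = 1)
    {T : Over S} (u v : T ⟶ A.X) :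
    CechPic.pullback (A.X ◁ (u * v)).left (AbelianSchemeOver.mumfordClass A c) =
      CechPic.pullback (A.X ◁ u).left (AbelianSchemeOver.mumfordClass A c) *
        CechPic.pullback (A.X ◁ v).left (AbelianSchemeOver.mumfordClass A c) := by
  have key := A.cubeClass_eq_one_of_isLocallyNoetherian c hc (fst A.X T) (snd A.X T ≫ u) (snd A.X T ≫ v)
  rw [← MonObj.comp_mul, ← A.whiskerLeft_eq_lift, ← A.whiskerLeft_eq_lift, ← A.whiskerLeft_eq_lift, mul_inv_eq_one,
    mul_inv_eq_iff_eq_mul] at key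
  rw [key, mul_comm]

/-- **THE THEOREM OF THE SQUARE, module form — UNCONDITIONAL over a locally Noetherian base**: for `L` of rank one on `A`
rigidified along the zero section and all `u, v : T → A` over `S`, `Λ(L)|_{u·v} ≅ Λ(L)|_u ⊗ Λ(L)|_v` on `A ×_S T`
(compare ★ `nonempty_pullback_whiskerLeft_mul_mumfordBundle_iso`: no dual pair, no `PreconnectedSpace S`).
[cite: MumfordAV1970, §6 Cor. 4 (p. 59)] [cite: MumfordFogartyKirwan1994, Ch. 6 §2 Definition 6.2 (p. 120)] -/
theorem nonempty_pullback_whiskerLeft_mul_mumfordBundle_iso_of_isLocallyNoetherian {L : A.left.Modules} (hL : HasRank L 1)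
    (hε : CechPic.pullback A.unitSection (detClass (HasRank.isFiniteLocallyFree' hL)) = 1)
    {T : Over S} (u v : T ⟶ A.X) :
    Nonempty ((Scheme.Modules.pullback (A.X ◁ (u * v)).left).obj (AbelianSchemeOver.mumfordBundle A L) ≅
      tensorObj ((Scheme.Modules.pullback (A.X ◁ u).left).obj (AbelianSchemeOver.mumfordBundle A L))
        ((Scheme.Modules.pullback (A.X ◁ v).left).obj (AbelianSchemeOver.mumfordBundle A L))) := by
  have hΛ : IsFiniteLocallyFree (A.mumfordBundle L) := HasRank.isFiniteLocallyFree' (A.hasRank_mumfordBundle hL)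
  have h1 : ∀ w : T ⟶ A.X, HasRank ((Scheme.Modules.pullback (A.X ◁ w).left).obj (A.mumfordBundle L)) 1 :=
    fun w => hasRank_pullback _ (A.hasRank_mumfordBundle hL)
  refine (nonempty_iso_iff_detClass_eq (h1 (u * v)) (hasRank_tensorObj_one (h1 u) (h1 v)) (hΛ.pullback _)
    (isFiniteLocallyFree_tensorObj _ _ (hΛ.pullback _) (hΛ.pullback _))).2 ?_
  rw [detClass_tensorObj_of_hasRank_one (h1 u) (h1 v) (hΛ.pullback _) (hΛ.pullback _), detClass_pullback _ hΛ,
    detClass_pullback _ hΛ, detClass_pullback _ hΛ, A.detClass_mumfordBundle hL hΛ]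
  exact A.cechPic_pullback_whiskerLeft_mul_mumfordClass_of_isLocallyNoetherian _ hε u v

end Global

end AbelianSchemeOver

end Literature.AlgebraicGeometry.AbelianSchemes

end
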